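import Literature.AlgebraicGeometry.Resolution.WeightedCentreZKernelFlow
import Literature.AlgebraicGeometry.Resolution.WeightedCentreFlowExtraction
import HarnessLib

/-!
# Weighted centres — THEOREM B of the `W(f)` toy model, case `r = 1` and the unconditional assembly (T107, part 3)

Instrument for engine 1's `W(f)` TOY MODEL (cell `pub-rosobs`, LF-MODEL-eng1-g45 §6.3), NOT a resolution theorem and NOT about the
invariant of [AbramovichTemkinWlodarczyk2024].  Parts 1–2 (`WeightedCentreZKernel`, `WeightedCentreZKernelFlow`) reduced THEOREM B —
"`𝒢(N) ∩ Stab(g) = {1}`: a graded `k[σ]`-automorphism `X₀ ≡ id (mod σ)` of `k[ε][σ]` that is `Z`-infinitesimal (`X₀ ≡ id mod (ε_Z)`), fixes the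
slots `V` of weight `> p + 1` and fixes `g` is trivial, provided `(N, g)` carries no tailed light flow" — to its case `r = 1` (`ZKernel.CaseOne`:
an `X₀` whose torus-orbit group `H₀` has `H₀ ∩ 𝔄_2 = {1}` is trivial).  This file proves that case and assembles THEOREM B unconditionally
(`ZKernel.caseOne`, `ZKernel.eq_one`, `ZKernel.inf_stabilizer_eq_bot`).

## The argument (LF-MODEL-eng1-g45 §6.3, case `r = 1`; RE-DERIVATION-eng1-g44 §3.5)

Let `X₀ ≠ 1` with `H₀ ∩ 𝔄_2 = {1}`.  Then `π_1(X₀) ≠ 0` and the eigen-relation is EXACT at level `1`: `s_μ X₀ = X₀^{N(μ)}` (`N(μ) ≡ μ`;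
`EigenLift.sConj_eq_pow_of_levelIn_succ_eq_bot`).  Read `𝔇 := π_1(X₀)` as a derivation of `k[ε]` (triangular of degree `−1`, data in `(ε_Z)`,
killing `ε_Z` and `ε_V`; `ZKernel.projDer`).  The truncated flow `Ψ_𝔇(σ) : ε_i ↦ T ε_i = Σ_{n<p} u_n 𝔇^n(ε_i) σ^n`, `σ ↦ σ`, is a graded endomorphism
`≡ id (mod σ)`, hence an honest AUTOMORPHISM `Φ♯` of `k[ε][σ]` (`UnipotentInverse.toRingEquiv`; `ZKernel.flowSharp`) — its inverse is NOT a flow, but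
its underlying endomorphism IS `Ψ_𝔇(σ)`.  In the `Q`-stable group `K = baseFixing ⊓ 𝔄_1` we have `π_1(Φ♯) = 𝔇 = π_1(X₀)`, so `X₀⁻¹ Φ♯ ∈ 𝔄_2`; `X₀` is an
EXACT eigen-element and `Φ♯` an APPROXIMATE one: `s_μ Φ♯ = (Φ♯)^{N(μ)} · h` with `h ∈ K ∩ 𝔄_p`, because `s_c Ψ_σ ≡ Ψ_σ^N (mod σ^p)` for `c = N`
(`TruncatedFlow.X_pow_dvd_rescaleHom_flow_sub_pow`).  No level `2 ≤ m < p` is resonant with level `1` for a generator `μ₀` of `𝔽_pˣ`, so the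
(non-exact) eigen-CLIMB `EigenLift.eigen_climb` — run UPSTAIRS in `Aut k[ε][σ]`, with the roles "exact = `X₀`", "approximate = `Φ♯`", terminal level
`t = p` — gives `X₀⁻¹ Φ♯ ∈ 𝔄_p`, i.e. `X₀ ≡ Ψ_𝔇(σ) (mod σ^p)`.  (This replaces the engine's passage to the truncated group `Aut(k[ε][σ]/σ^p)`: no quotient
ring is needed.)  Since `X₀` has no terms of `σ`-order `> p` (orders `≤ w_i − ζ < p + 1` on the slots of weight `≤ p + 1`, the others fixed), flow
extraction (`TailedLightFlow.eq_subst`) identifies `X₀ = Φ_{(𝔇, q)}(σ)` with `q_i := π_p(X₀)_i`, and `(𝔇, q)` is a tailed light flow of unit `1` on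
`(N, g)` (`ZKernel.false_of_apply_eq_substC`) — contradicting THEOREM 𝔉′.

All algebra is textbook: automorphisms and substitution endomorphisms of polynomial rings and their congruence filtration [Lang2002, Ch. I §3,
Ch. IV §1, Ch. V §5], derivations and truncated exponentials in characteristic `p` [Matsumura1987, §25, §27], the torus `𝔽_pˣ` acting by `σ ↦ μσ`
[SerreLocalFields1979, Ch. II §4 Lemma 1]; the weighted-homogeneity bookkeeping follows [AbramovichTemkinWlodarczyk2024, §5.1, Thm. 5.3.1 (2)–(3)]
only as a dictionary for the toy model.
-/

namespace Literature.AlgebraicGeometry.Resolution.WeightedBlowup.ZKernel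

open Polynomial OrderFiltration LevelProjection EigenLiftLevels EigenLift TruncatedFlow

variable {k : Type*} [CommRing k] {ι : Type*}

/-! ## `Φ♯`: the truncated flow `Ψ_𝔇(σ)` as an automorphism of `k[ε][σ]` -/

section Sharp

variable {w : ι → ℚ} (D : Derivation k (MvPolynomial ι k) (MvPolynomial ι k)) (p : ℕ) (u : ℕ → k)
  (hu : ∀ n < p, (Nat.factorial n : k) * u n = 1) (hp : 1 ≤ p) (hw : ∀ i, 0 ≤ w i)
  (hD : ∀ (a : MvPolynomial ι k) (m : ℚ), MvPolynomial.IsWeightedHomogeneous w a m →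
    MvPolynomial.IsWeightedHomogeneous w (D a) (m - 1))

/-- `⟪σ⟫` has total weight `1` for `wt σ = 1` (bookkeeping: the hypothesis of `TruncatedFlow.isGradedHom_flow` for `τ = σ`).
[cite: AbramovichTemkinWlodarczyk2024, Thm. 5.3.1 (2)–(3) (p. 1578)] -/
theorem isTW_map_X : IsTW w (1 : ℚ) (1 : ℚ) ((X : k[X]).map (MvPolynomial.C : k →+* MvPolynomial ι k)) := by
  rw [Polynomial.map_X]
  exact isTW_X

/-- **`Φ♯`**: for a derivation `𝔇` of `k[ε]` lowering `w`-weights by `1` (non-negative slot weights, `u_n n! = 1` for `n < p`, `1 ≤ p`), the truncated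
flow `Ψ_𝔇(σ) : ε_i ↦ Σ_{n<p} u_n 𝔇^n(ε_i) σ^n`, `σ ↦ σ` is a GRADED endomorphism of `k[ε][σ]` `≡ id (mod σ)`, hence an automorphism
(`UnipotentInverse.toRingEquiv`; its inverse is not a flow, its underlying endomorphism is `TruncatedFlow.flow 𝔇 p u σ`).  Construction; instrument for
engine 1's `W(f)` toy model, NOT a resolution theorem. [cite: Matsumura1987, §27 (pp. 207–209); Lang2002, Ch. IV §1; AbramovichTemkinWlodarczyk2024, Thm. 5.3.1 (2)–(3) (p. 1578)] -/
noncomputable def flowSharp : (MvPolynomial ι k)[X] ≃+* (MvPolynomial ι k)[X] :=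
  UnipotentInverse.toRingEquiv (flow D p u X) (isGradedHom_flow D p u hD isTW_map_X) (flow_X D p u X)
    (fun i => by
      have h := X_pow_dvd_flow_sub_self D p u hu hp (by rw [pow_one]) (C (MvPolynomial.X i))
      rwa [pow_one] at h)
    hw one_pos

/-- `Φ♯` is `Ψ_𝔇(σ)` on elements (plumbing). [cite: Matsumura1987, §27 (pp. 207–209)] -/
theorem flowSharp_apply (y : (MvPolynomial ι k)[X]) : flowSharp D p u hu hp hw hD y = flow D p u X y := rfl

/-- `Φ♯` is `Ψ_𝔇(σ)` as a ring endomorphism (plumbing). [cite: Matsumura1987, §27 (pp. 207–209)] -/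
theorem coe_flowSharp :
    ((flowSharp D p u hu hp hw hD : (MvPolynomial ι k)[X] ≃+* (MvPolynomial ι k)[X]) : (MvPolynomial ι k)[X] →+* (MvPolynomial ι k)[X]) =
      flow D p u X :=
  RingHom.ext fun _ => rfl

/-- Powers of `Φ♯` are powers of `Ψ_𝔇(σ)` on elements (plumbing). [cite: Lang2002, Ch. I §3] -/
theorem flowSharp_pow_apply (N : ℕ) (y : (MvPolynomial ι k)[X]) :
    (flowSharp D p u hu hp hw hD ^ N) y = (flow D p u X ^ N) y := by
  rw [RingAut.coe_pow, RingHom.coe_pow]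
  rfl

/-- `Φ♯` is a `k[σ]`-automorphism in `𝔄_1` (bookkeeping, `LevelProjection.toRingEquiv_mem`). [cite: Lang2002, Ch. IV §1] -/
theorem flowSharp_mem :
    flowSharp D p u hu hp hw hD ∈ baseFixing ∧ flowSharp D p u hu hp hw hD ∈ level (X : (MvPolynomial ι k)[X]) 1 :=
  (toRingEquiv_mem (isGradedHom_flow D p u hD isTW_map_X) (flow_X D p u X) _ hw one_pos).2

/-- **`π_1(Φ♯) = 𝔇`**: the level-`1` datum of `Ψ_𝔇(σ)` on the slot `ε_i` is `u_1 𝔇(ε_i) = 𝔇(ε_i)` (`2 ≤ p`; derived here).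
[cite: Matsumura1987, §27 (pp. 207–209); Lang2002, Ch. IV §1] -/
theorem proj_one_flowSharp (hp2 : 2 ≤ p) (i : ι) : proj 1 (flowSharp D p u hu hp hw hD) i = D (MvPolynomial.X i) := by
  have hu1 : u 1 = 1 := by
    have h := hu 1 (by omega)
    rwa [Nat.factorial_one, Nat.cast_one, one_mul] at h
  rw [proj_apply, flowSharp_apply, flow_C, flowC_X_eq, coeff_sub, coeff_sigmaExp_X, if_pos (by omega : 1 < p), Polynomial.coeff_C,
    if_neg one_ne_zero, sub_zero, Function.iterate_one, hu1, one_smul]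

/-- **`Φ♯` is an APPROXIMATE eigen-element of the torus**: `σ^p ∣ (s_μ Φ♯) y − (Φ♯)^N y` for `N ≡ μ (mod p)` — because `s_c Ψ_σ = Ψ_{cσ}` and
`Ψ_σ^N ≡ Ψ_{Nσ} (mod σ^p)` (`TruncatedFlow.X_pow_dvd_rescaleHom_flow_sub_pow`; `char k = p`).  Instrument, NOT a resolution theorem.
[cite: Matsumura1987, §27 (pp. 207–209); SerreLocalFields1979, Ch. II §4 Lemma 1; Lang2002, Ch. V §5] -/
theorem X_pow_dvd_scaleConj_flowSharp_sub [Fact p.Prime] [CharP k p] {μ : (ZMod p)ˣ} {N : ℕ} (hN : (N : ZMod p) = (μ : ZMod p))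
    (y : (MvPolynomial ι k)[X]) :
    X ^ p ∣ scaleConj (castUnit p μ) (flowSharp D p u hu hp hw hD) y - (flowSharp D p u hu hp hw hD ^ N) y := by
  have h := X_pow_dvd_rescaleHom_flow_sub_pow D p u hu hp N y
  rw [← flowSharp_pow_apply D p u hu hp hw hD N y, natCast_eq_castHom p hN, ← val_castUnit p μ, ← coe_flowSharp D p u hu hp hw hD,
    ← coe_scaleConj (castUnit p μ) (flowSharp_mem D p u hu hp hw hD).1, RingEquiv.coe_toRingHom] at h
  exact h

end Sharp

/-! ## CASE `r = 1` OF THEOREM B -/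

section CaseOne

variable {w : ι → ℚ} {Z : Set ι} {ζ : ℚ} (p : ℕ) [Fact p.Prime] [CharP k p] {u : ℕ → k} {g : MvPolynomial ι k}

/-- **CASE `r = 1` OF THEOREM B** (LF-MODEL-eng1-g45 §6.3, last case; `ZKernel.CaseOne` holds): in the setting — `char k = p`, `u_n n! = 1` (`n < p`), non-negative slot
weights, bottom light class `Z` of weight in `[ζ, p)`, `ζ > 0`, `V ⊇` the slots of weight `> p + 1` — and IF `(N, g)` carries no tailed light flow (THEOREM 𝔉′), a graded
`k[σ]`-automorphism `X₀ ≡ id (mod σ)` that is `Z`-infinitesimal, fixes `ε_V` and `g`, and whose torus-orbit group `H₀` has `H₀ ∩ 𝔄_2 = {1}`, is trivial.  Proof: the eigen-climb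
`EigenLift.eigen_climb` in `K = baseFixing ⊓ 𝔄_1` with EXACT element `X₀` (`s_{μ₀} X₀ = X₀^{n₀}`, `EigenLift.sConj_eq_pow_of_levelIn_succ_eq_bot`) and APPROXIMATE element
`Φ♯ = Ψ_𝔇(σ)`, `𝔇 = π_1(X₀)` (`X_pow_dvd_scaleConj_flowSharp_sub`), terminal level `p`, gives `X₀ ≡ Ψ_𝔇(σ) (mod σ^p)`; flow extraction (`TailedLightFlow.eq_subst`) and
`false_of_apply_eq_substC` produce a tailed light flow `(𝔇, π_p(X₀))` of unit `1`.  Instrument for engine 1's `W(f)` toy model, NOT a resolution theorem.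
[cite: Lang2002, Ch. I §§3, 6, Ch. IV §1, Ch. V §5; Matsumura1987, §27 (pp. 207–209); SerreLocalFields1979, Ch. II §4 Lemma 1; AbramovichTemkinWlodarczyk2024, §5.1 (p. 1575), Thm. 5.3.1 (2)–(3) (p. 1578)] -/
theorem caseOne (hu : ∀ n < p, (Nat.factorial n : k) * u n = 1) (hw : ∀ i, 0 ≤ w i) (hZ : ∀ z ∈ Z, ζ ≤ w z) (hζ : 0 < ζ)
    (hZp : ∀ z ∈ Z, w z < p) {V : Set ι} (hVw : ∀ i, w i ≤ (p : ℚ) + 1 ∨ i ∈ V) (hN : TailedLightFlow.NoTailedLightFlow p u w g) :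
    CaseOne p w Z V g := by
  intro X₀ hg hb h1 hk hV hfix hbot
  by_contra hne
  have hp2 : 2 ≤ p := (Fact.out : p.Prime).two_le
  have hp1 : 1 ≤ p := by omega
  have hg1 : IsGradedHom w (1 : ℚ) (X₀ : (MvPolynomial ι k)[X] →+* (MvPolynomial ι k)[X]) := hg.1
  have hXV : ∀ i, (p : ℚ) + 1 < w i → X₀ (C (MvPolynomial.X i)) = C (MvPolynomial.X i) := fun i hi => by
    rcases hVw i with h | h
    · exact absurd hi (not_lt.mpr h)
    · exact hV i h
  -- the orbit group `H₀` of `X₀`: exactness at the deepest level `1`, and `π_1(X₀) ≠ 0`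
  have hle := orbitGroup_le p hg hb h1 hk hV hfix
  have hH1 : orbitGroup p X₀ ≤ level (X : (MvPolynomial ι k)[X]) 1 := fun A hA => (hle hA).1.1.1.2
  have hHb : orbitGroup p X₀ ≤ baseFixing := fun A hA => (hle hA).1.1.1.1.2
  have hmem : (⟨X₀, mem_orbitGroup_self p X₀⟩ : orbitGroup p X₀) ∈ levelIn (X : (MvPolynomial ι k)[X]) (orbitGroup p X₀) 1 :=
    mem_levelIn.mpr h1
  obtain ⟨μ₀, hμ₀⟩ := exists_orderOf_eq (p := p)
  set n₀ : ℕ := (μ₀ : ZMod p).val with hn₀def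
  have hn₀ : (n₀ : ZMod p) = (μ₀ : ZMod p) := ZMod.natCast_zmod_val _
  have hn₀1 : (n₀ : ZMod p) = (μ₀ : ZMod p) ^ 1 := by rw [pow_one, hn₀]
  have hsx : scaleConj (castUnit p μ₀) X₀ = X₀ ^ n₀ := by
    have h := sConj_eq_pow_of_levelIn_succ_eq_bot hH1 hHb (orbitGroup_stable p X₀) (r := 1) hbot μ₀ hn₀1 hmem
    have h' := congrArg Subtype.val h
    rwa [coe_sConj, Subgroup.coe_pow] at h'
  have hx0 : ∃ i, proj 1 X₀ i ≠ 0 := by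
    by_contra hall
    push Not at hall
    have h := eq_one_of_proj_eq_zero hHb (r := 1) hbot hmem hall
    exact hne (by simpa using congrArg Subtype.val h)
  -- `𝔇 := π_1(X₀)` and `Φ♯ = Ψ_𝔇(σ)`
  set D := projDer 1 X₀ with hDdef
  have hDX : ∀ i, MvPolynomial.IsWeightedHomogeneous w (D (MvPolynomial.X i)) (w i - (1 : ℚ)) := fun i => by
    have h := isWeightedHomogeneous_projDer hg1 1 i
    rwa [Nat.cast_one] at h
  have hD : ∀ (a : MvPolynomial ι k) (m : ℚ), MvPolynomial.IsWeightedHomogeneous w a m →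
      MvPolynomial.IsWeightedHomogeneous w (D a) (m - 1) := fun a m ha => TailedLightFlow.lowers_of_X D hDX ha
  set Φ := flowSharp D p u hu hp1 hw hD with hΦdef
  have hΦb : Φ ∈ baseFixing := (flowSharp_mem D p u hu hp1 hw hD).1
  have hΦ1 : Φ ∈ level (X : (MvPolynomial ι k)[X]) 1 := (flowSharp_mem D p u hu hp1 hw hD).2
  -- the ambient `Q`-stable group `K = baseFixing ⊓ 𝔄_1`
  set K : Subgroup ((MvPolynomial ι k)[X] ≃+* (MvPolynomial ι k)[X]) := baseFixing ⊓ level (X : (MvPolynomial ι k)[X]) 1 with hKdef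
  have hQ : ∀ μ : (ZMod p)ˣ, ∀ A ∈ K, scaleConj (castUnit p μ) A ∈ K := fun μ A hA =>
    ⟨scaleConj_mem_baseFixing _ hA.1, scaleConj_mem_level _ hA.1 hA.2⟩
  have hK1 : K ≤ level (X : (MvPolynomial ι k)[X]) 1 := fun A hA => hA.2
  have hKb : K ≤ baseFixing := fun A hA => hA.1
  have hΦK : Φ ∈ K := ⟨hΦb, hΦ1⟩
  have hX₀K : X₀ ∈ K := ⟨hb, h1⟩
  -- `X₀⁻¹ Φ♯ ∈ 𝔄_2`: `π_1(Φ♯) = 𝔇 = π_1(X₀)`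
  have hX₀i : X₀⁻¹ ∈ level (X : (MvPolynomial ι k)[X]) 1 := (level _ 1).inv_mem h1
  have hE : (⟨X₀, hX₀K⟩ : K)⁻¹ * ⟨Φ, hΦK⟩ ∈ levelIn (X : (MvPolynomial ι k)[X]) K 2 := by
    show X₀⁻¹ * Φ ∈ level (X : (MvPolynomial ι k)[X]) (1 + 1)
    refine mem_level_succ_of_proj_eq_zero (mul_mem hX₀i hΦ1) (mul_mem (baseFixing.inv_mem hb) hΦb) fun i => ?_
    rw [proj_mul le_rfl hX₀i hΦ1, proj_inv le_rfl h1, hΦdef, proj_one_flowSharp D p u hu hp1 hw hD hp2 i, hDdef, projDer_X,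
      neg_add_cancel]
  -- `Φ♯` is an approximate eigen-element: `s_{μ₀} Φ♯ = (Φ♯)^{n₀} · h`, `h ∈ K ∩ 𝔄_p`
  have hsΦK : scaleConj (castUnit p μ₀) Φ ∈ K := hQ μ₀ Φ hΦK
  have hΦNK : Φ ^ n₀ ∈ K := K.pow_mem hΦK n₀
  have hhK : (Φ ^ n₀)⁻¹ * scaleConj (castUnit p μ₀) Φ ∈ K := K.mul_mem (K.inv_mem hΦNK) hsΦK
  have hΦNX : (Φ ^ n₀) X = X := ((level (X : (MvPolynomial ι k)[X]) 1).pow_mem hΦ1 n₀).1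
  have hh : (⟨(Φ ^ n₀)⁻¹ * scaleConj (castUnit p μ₀) Φ, hhK⟩ : K) ∈ levelIn (X : (MvPolynomial ι k)[X]) K p := by
    show (Φ ^ n₀)⁻¹ * scaleConj (castUnit p μ₀) Φ ∈ level (X : (MvPolynomial ι k)[X]) p
    refine ⟨hhK.1.1, fun y => ?_⟩
    obtain ⟨t, ht⟩ := X_pow_dvd_scaleConj_flowSharp_sub D p u hu hp1 hw hD hn₀ y
    have ht' : scaleConj (castUnit p μ₀) Φ y = (Φ ^ n₀) y + X ^ p * t := by rw [← ht, hΦdef]; ring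
    refine ⟨(Φ ^ n₀).symm t, ?_⟩
    rw [RingAut.mul_apply, RingAut.inv_apply, ht', map_add, map_mul, map_pow, symm_apply_eq_self hΦNX, RingEquiv.symm_apply_apply]
  have hΦexact : sConj K hQ μ₀ ⟨X₀, hX₀K⟩ = ⟨X₀, hX₀K⟩ ^ n₀ := Subtype.ext (by
    rw [coe_sConj, Subgroup.coe_pow]
    exact hsx)
  have hx : sConj K hQ μ₀ ⟨Φ, hΦK⟩ = ⟨Φ, hΦK⟩ ^ n₀ * ⟨(Φ ^ n₀)⁻¹ * scaleConj (castUnit p μ₀) Φ, hhK⟩ := Subtype.ext (by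
    rw [coe_sConj, Subgroup.coe_mul, Subgroup.coe_pow, mul_inv_cancel_left])
  -- the eigen-climb: `X₀⁻¹ Φ♯ ∈ 𝔄_p`
  have hres : ∀ m, 2 ≤ m → m < p → μ₀ ^ m ≠ μ₀ ^ 1 := fun m hm1 hm2 => nonresonant_of_orderOf hμ₀ (by omega) (by omega)
  have hclimb := eigen_climb hK1 hKb hQ μ₀ (r := 1) n₀ hn₀1 (a := 2) (t := p) hp2 hres hE hh hΦexact hx
  -- `X₀ ≡ Ψ_𝔇(σ) (mod σ^p)` on the slots
  have hcong : ∀ i, X ^ p ∣ X₀ (C (MvPolynomial.X i)) - sigmaExp D p u (MvPolynomial.X i) := fun i => by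
    obtain ⟨z, hz⟩ := (mem_levelIn.mp hclimb).2 (C (MvPolynomial.X i))
    have hz' : X₀.symm (Φ (C (MvPolynomial.X i))) = C (MvPolynomial.X i) + X ^ p * z := hz
    have e : Φ (C (MvPolynomial.X i)) = X₀ (C (MvPolynomial.X i) + X ^ p * z) := by
      rw [← hz', RingEquiv.apply_symm_apply]
    rw [map_add, map_mul, map_pow, hb.1, hΦdef, flowSharp_apply, flow_C, flowC_X_eq] at e
    exact ⟨-X₀ z, by rw [e]; ring⟩
  -- no terms of order `> p`
  have hdeg : ∀ i n, p < n → (X₀ (C (MvPolynomial.X i))).coeff n = 0 := fun i n hn => by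
    have h0 : proj n X₀ i = 0 := by
      rcases hVw i with hi | hi
      · have hn' : (p : ℚ) + 1 ≤ n := by exact_mod_cast hn
        exact proj_eq_zero_of_lt hw hZ hg1 hk (by linarith)
      · exact proj_eq_zero_of_fix (hV i hi)
    rwa [proj_apply, coeff_sub, Polynomial.coeff_C, if_neg (by omega : n ≠ 0), sub_zero] at h0
  -- flow extraction: `X₀ = Φ_{(𝔇, q)}(σ)`, `q_i = π_p(X₀)_i`
  have hsubst := TailedLightFlow.eq_subst D p u (Φ := (X₀ : (MvPolynomial ι k)[X] →+* (MvPolynomial ι k)[X])) hb.1 hb.2 hcong hdeg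
  set q : ι → MvPolynomial ι k := fun i => ((X₀ : (MvPolynomial ι k)[X] →+* (MvPolynomial ι k)[X]) (C (MvPolynomial.X i))).coeff p with hqdef
  have hq : ∀ i, q i = proj p X₀ i := fun i => by
    rw [hqdef, proj_apply, coeff_sub, Polynomial.coeff_C, if_neg (by omega : p ≠ 0), sub_zero, RingEquiv.coe_toRingHom]
  have hA : ∀ i, X₀ (C (MvPolynomial.X i)) = TailedLightFlow.substC D p u q (MvPolynomial.X i) := fun i => by
    have h := RingHom.congr_fun hsubst (C (MvPolynomial.X i))
    rwa [RingEquiv.coe_toRingHom, TailedLightFlow.subst_C] at h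
  have hqV : ∀ i, (p : ℚ) + 1 < w i → q i = 0 := fun i hi => by rw [hq i, proj_eq_zero_of_fix (hXV i hi)]
  exact false_of_apply_eq_substC hN one_pos hDX (vars_projDer hw hZ hζ hZp hg1 hk hXV le_rfl) (fun i hi => projDer_X_of_V hXV 1 i hi)
    (fun i => by
      rw [hq i, nsmul_eq_mul, mul_one]
      exact isWeightedHomogeneous_proj hg1 p i)
    (fun i j hj => by
      rcases le_or_gt (w i) ((p : ℚ) + 1) with hi | hi
      · rw [hq i] at hj
        exact (vars_proj hw hZ hζ hZp hg1 hk hp1 hi hj).1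
      · rw [hqV i hi, MvPolynomial.vars_0] at hj
        exact absurd hj (Finset.notMem_empty j))
    (fun i hi => hi.elim (fun hi => by rw [hq i]; exact proj_eq_zero_of_lt hw hZ hg1 hk (by linarith)) (fun hi => hqV i hi))
    (Or.inl (hx0.imp fun i hi => by rwa [hDdef, projDer_X])) hb.2 hA hfix

/-! ## THEOREM B, unconditional -/

/-- **THEOREM B** (LF-MODEL-eng1-g45 §6.3 "`𝒢(N) ∩ Stab(g) = {1}`", typed assembly T107 of CARVER-NOTES-eng1-g43 and eng1-g44, now UNCONDITIONAL given THEOREM 𝔉′ as the hypothesis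
`NoTailedLightFlow p u w g` — discharged by `TailedLightFlow.noTailedLightFlow`): in the setting — `char k = p`, `u_n n! = 1` (`n < p`), non-negative slot weights, bottom light
class `Z` of weight in `[ζ, p)`, `ζ > 0`, `V ⊇` the slots of weight `> p + 1` and `V` of weight `> p + 1` — every graded `k[σ]`-automorphism `X₀ ≡ id (mod σ)` of `k[ε][σ]` that is
`Z`-infinitesimal (`X₀ ≡ id mod (ε_Z)`), fixes `ε_V` and fixes `g` is the identity.  Proof: `eq_one_of_caseOne` (dispatch + cases `r = p`, `2 ≤ r ≤ p − 1`) + `caseOne`.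
Instrument for engine 1's `W(f)` toy model, NOT a resolution theorem and NOT about the invariant of the cited paper.
[cite: Lang2002, Ch. I §§3, 6, Ch. IV §1, Ch. V §5; Matsumura1987, §27 (pp. 207–209); SerreLocalFields1979, Ch. II §4 Lemma 1; AbramovichTemkinWlodarczyk2024, §5.1 (p. 1575), Thm. 5.3.1 (2)–(3) (p. 1578)] -/
theorem eq_one (hu : ∀ n < p, (Nat.factorial n : k) * u n = 1) (hw : ∀ i, 0 ≤ w i) (hZ : ∀ z ∈ Z, ζ ≤ w z) (hζ : 0 < ζ)
    (hZp : ∀ z ∈ Z, w z < p) {V : Set ι} (hVw : ∀ i, w i ≤ (p : ℚ) + 1 ∨ i ∈ V) (hwV : ∀ i ∈ V, (p : ℚ) + 1 < w i)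
    (hN : TailedLightFlow.NoTailedLightFlow p u w g)
    {X₀ : (MvPolynomial ι k)[X] ≃+* (MvPolynomial ι k)[X]} (hg : X₀ ∈ graded w (1 : ℚ)) (hb : X₀ ∈ baseFixing)
    (h1 : X₀ ∈ level (X : (MvPolynomial ι k)[X]) 1) (hk : X₀ ∈ zKernel Z) (hV : X₀ ∈ fixSlots V) (hfix : X₀ (C g) = C g) : X₀ = 1 :=
  eq_one_of_caseOne p hu hw hZ hζ hZp hVw hwV hN (caseOne p hu hw hZ hζ hZp hVw hN) hg hb h1 hk hV hfix

/-- **THEOREM B as a statement about groups**: `𝒢(N) ∩ Stab(g) = {1}` — the graded `Z`-infinitesimal `k[σ]`-isotropy group of `g` fixing `ε_V` inside `𝔄_1` is trivial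
(same hypotheses; bookkeeping restatement of `eq_one`).  Instrument for engine 1's `W(f)` toy model, NOT a resolution theorem.
[cite: Lang2002, Ch. I §3, Ch. IV §1; AbramovichTemkinWlodarczyk2024, §5.1 (p. 1575)] -/
theorem inf_stabilizer_eq_bot (hu : ∀ n < p, (Nat.factorial n : k) * u n = 1) (hw : ∀ i, 0 ≤ w i) (hZ : ∀ z ∈ Z, ζ ≤ w z) (hζ : 0 < ζ)
    (hZp : ∀ z ∈ Z, w z < p) {V : Set ι} (hVw : ∀ i, w i ≤ (p : ℚ) + 1 ∨ i ∈ V) (hwV : ∀ i ∈ V, (p : ℚ) + 1 < w i)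
    (hN : TailedLightFlow.NoTailedLightFlow p u w g) :
    graded w (1 : ℚ) ⊓ baseFixing ⊓ level (X : (MvPolynomial ι k)[X]) 1 ⊓ zKernel Z ⊓ fixSlots V ⊓
      MulAction.stabilizer ((MvPolynomial ι k)[X] ≃+* (MvPolynomial ι k)[X]) (C g : (MvPolynomial ι k)[X]) = ⊥ :=
  (Subgroup.eq_bot_iff_forall _).mpr fun _ hA =>
    eq_one p hu hw hZ hζ hZp hVw hwV hN hA.1.1.1.1.1 hA.1.1.1.1.2 hA.1.1.1.2 hA.1.1.2 hA.1.2 (MulAction.mem_stabilizer_iff.mp hA.2)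

end CaseOne

end Literature.AlgebraicGeometry.Resolution.WeightedBlowup.ZKernel
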